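import Literature.Probability.RandomPlanarGeometry.SAWTriangularConnectiveConstantLower12
import HarnessLib

/-!
# `μ(𝕋) > 3.932`: the last digit the twelve irreducible-bridge certificates support

Topic `Literature/Probability/RandomPlanarGeometry` (continues `SAWTriangularConnectiveConstantLower12.lean`). No new
computation: the kernel-certified counts `λ_n(𝕋) ≥ 3, 0, 4, 12, 20, 90, 242, 856, 2890, 10088, 35988, 129614`
(`n = 1, …, 12`, `SAWTriangularConnectiveConstantLower.lean` and `…12.lean`) give
`Σ_{n ≤ 12} λ_n(𝕋) (250/983)^n ≥ 1.00037 > 1`, hence `μ(𝕋) > 983/250 = 3.932` by Kesten's inequality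
(`inv_lt_exp_logMuTri_of_one_lt_sum`); the truncation at `n ≤ 12` cannot certify `3.933` (its root is `3.93277`),
so this is where the twelve certificates stop. Printed bounds by the same method reach `4.118935` (Jensen 2004 §2);
this one is weaker but kernel-checked. Axioms: standard plus the eleven `native_decide` count certificates of the
two imported files (nothing new is evaluated here).
-/

open Finset
open scoped BigOperators

namespace Literature.Probability.RandomPlanarGeometry.SAW

open TriIrrCert in
/-- **`μ(𝕋) > 3.932`**: `983/250 < exp logMuTri`. [cite: Jensen2004SAWLowerBounds, §2 (Kesten's method; `4.118935 < μ_tri`)]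
[cite: MadrasSlade1993, §4.2, eq. (4.2.3)–(4.2.4) (pp. 90–91)] -/
theorem exp_logMuTri_gt_983_div_250 : (983 : ℝ) / 250 < Real.exp logMuTri := by
  have hx : (0 : ℝ) < 250 / 983 := by norm_num
  have key : (1 : ℝ) < ∑ k ∈ Finset.range 13, (brickIrreducibleBridgeCount k : ℝ) * (250 / 983) ^ k := by
    have h1 : (3 : ℝ) ≤ brickIrreducibleBridgeCount 1 := by exact_mod_cast three_le_lambda_one
    have h2 : (0 : ℝ) ≤ brickIrreducibleBridgeCount 2 := Nat.cast_nonneg _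
    have h3 : (4 : ℝ) ≤ brickIrreducibleBridgeCount 3 := by exact_mod_cast four_le_lambda_three
    have h4 : (12 : ℝ) ≤ brickIrreducibleBridgeCount 4 := by exact_mod_cast le_lambda_four
    have h5 : (20 : ℝ) ≤ brickIrreducibleBridgeCount 5 := by exact_mod_cast le_lambda_five
    have h6 : (90 : ℝ) ≤ brickIrreducibleBridgeCount 6 := by exact_mod_cast le_lambda_six
    have h7 : (242 : ℝ) ≤ brickIrreducibleBridgeCount 7 := by exact_mod_cast le_lambda_seven
    have h8 : (856 : ℝ) ≤ brickIrreducibleBridgeCount 8 := by exact_mod_cast le_lambda_eight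
    have h9 : (2890 : ℝ) ≤ brickIrreducibleBridgeCount 9 := by exact_mod_cast le_lambda_nine
    have h10 : (10088 : ℝ) ≤ brickIrreducibleBridgeCount 10 := by exact_mod_cast le_lambda_ten
    have h11 : (35988 : ℝ) ≤ brickIrreducibleBridgeCount 11 := by exact_mod_cast le_lambda_eleven
    have h12 : (129614 : ℝ) ≤ brickIrreducibleBridgeCount 12 := by exact_mod_cast le_lambda_twelve
    simp only [Finset.sum_range_succ, Finset.sum_range_zero, brickIrreducibleBridgeCount_zero, Nat.cast_zero,
      zero_mul, zero_add, pow_one]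
    norm_num
    linarith [h1, h2, h3, h4, h5, h6, h7, h8, h9, h10, h11, h12]
  have := inv_lt_exp_logMuTri_of_one_lt_sum _ hx key
  rwa [inv_div] at this

/-- `log 3.932 < log μ(𝕋)`. [cite: Jensen2004SAWLowerBounds, §2] -/
theorem log_983_div_250_lt_logMuTri : Real.log ((983 : ℝ) / 250) < logMuTri := by
  have h := Real.log_lt_log (by norm_num) exp_logMuTri_gt_983_div_250
  rwa [Real.log_exp] at h

end Literature.Probability.RandomPlanarGeometry.SAW
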